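import Summits.BirchSwinnertonDyer.BirchSwinnertonDyer.Theorems.ByReductionTypeAtTwoRankOneAtTwoBigImageOddLocalFklLevelParity
import Literature.NumberTheory.EllipticCurves.BSDRootNumberOddParityProofs
import HarnessLib

/-!
# Line `fkl` of crux `RankOneAtTwoBigImageOddLocal` (stmt-BirchSwinnertonDyer-23715, route ByReductionTypeAtTwo):
# clause (a) of K2-F / K2-F_an in the stubs' OWN binders — proved for parameter `0`, proved mod `2` in general

Lead prover seat `bsd-line-fkl-p1` (g0), helpers `--supports stmt-BirchSwinnertonDyer-23715` (registered stubs
`stub_katoFirstLayerLaw : F1Sign2.FirstLayerLawAtTwo`, `stub_analyticKatoFirstLayerLaw : F1Sign2.AnalyticFirstLayerLawAtTwo`);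
packaging of `…FklLevelParity.levelSumTwo_inTwoPowZLoc_one` (p594285) under the exact hypotheses of the two stubs.

K2-F (`F1Sign2.FirstLayerLawAtTwo`) = ∀ (slice curve `W`, newform `f`, period transfer, `w = −1`, rank 1, `Ш[2^∞]` finite),
with `s := ord₂ #Ш[2^∞]`: (a) every row `(ℓ, k, ψ)` of the first layer has `δ'_k(ℓ;ψ) ∈ 2^{min(k,s+1)} ℤ_{(2)}`; (b) some row
with `k ≥ s+2` has `δ'_k(ℓ;ψ) ∉ 2^{s+2} ℤ_{(2)}`.  Here, with NO input beyond the tree's proved theorems (`w = −1 ⇒ r_an ≥ 1`,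
`WeierstrassCurve.analyticRank_pos_of_rootNumber_eq_neg_one`):
* `firstLayerLawAtTwo_clauseA_mod_two` — under K2-F's binders every row has `δ'_k(ℓ;ψ) ∈ 2ℤ_{(2)}` (the `j = 1` shadow of (a));
* `firstLayerLawAtTwo_clauseA_of_sha_two_eq_one` — under K2-F's binders and `#Ш(E)[2^∞] = 1` (`s = 0`), clause (a) VERBATIM;
* `analyticFirstLayerLawAtTwo_clauseA_mod_two`, `analyticFirstLayerLawAtTwo_clauseA_of_padicValRat_le` — the same for K2-F_an
  (`s_an = (ord₂ q).toNat = 0` iff `ord₂ Ш_an ≤ 0`).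
So on the slice the OPEN content of the two laws is: clause (a) at levels `2 ≤ k` for `s ≥ 1` (the higher congruence
`mod 2^{min(k,s+1)}`), and clause (b) (one `τ`-prime of level `≥ s+2` where `δ'` is NOT divisible by `2^{s+2}` — Kolyvagin
non-triviality at `2`).  The binders period transfer / big image / odd torsion / odd Tamagawa / `2^k ∣ a_ℓ − 2` are idle in all
four theorems.  Theorems only; no `def`, no named-fact hypothesis, no `sorry`.  BSD is not proved by any of this.
-/

set_option autoImplicit false

noncomputable section

open scoped Classical MatrixGroups ModularForm

set_option linter.dupNamespace false

namespace Summit.BirchSwinnertonDyer.BirchSwinnertonDyer.Theorems.RankOneAtTwoFkl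

open CongruenceSubgroup WeierstrassCurve Literature.NumberTheory.EllipticCurves
  Literature.NumberTheory.EllipticCurves.ModularForms Summit.BirchSwinnertonDyer.Rank1Residual.F1Sign2

/-- A `τ`-prime is odd and prime to the conductor (`IsLevelAtTwo W ℓ` says `ℓ ∤ 2N_W`). [folklore] -/
theorem ne_two_and_not_dvd_of_isLevelAtTwo (W : WeierstrassCurve ℚ) [W.IsElliptic] [W.IsGloballyMinimal]
    {ℓ : ℕ} [Fact ℓ.Prime] (hlev : IsLevelAtTwo W ℓ) : ℓ ≠ 2 ∧ ¬ ℓ ∣ W.conductorNorm ℤ := by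
  have h2N : ¬ ℓ ∣ 2 * W.conductorNorm ℤ := (hlev.2 ℓ (dvd_refl ℓ)).1
  refine ⟨?_, fun h => h2N (dvd_mul_of_dvd_right h 2)⟩
  rintro rfl
  exact h2N (dvd_mul_right 2 _)

/-- **Clause (a) of K2-F holds modulo `2` — under the stub's own binders.**  In the setting of `F1Sign2.FirstLayerLawAtTwo`
(any of its hypotheses; only `w(E) = −1`, through `r_an ≥ 1`, and the newform are used) EVERY row `(ℓ, k, ψ)` of the first
Kolyvagin layer has `δ'_k(ℓ; ψ) ∈ 2ℤ_{(2)}`. [conjecture] shadow, kernel theorem. -/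
theorem firstLayerLawAtTwo_clauseA_mod_two :
    ∀ (W : WeierstrassCurve ℚ) [W.IsElliptic] [W.IsGloballyMinimal] {M : ℕ} [NeZero M]
      (f : CuspForm (Gamma0 M) 2), IsNewformOf W f → PeriodTransferAtTwo W f →
      (∀ n : ℕ, W.HasSurjectiveModNGaloisRep ((2 ^ n : ℕ) : ℤ)) → Odd W.torsionOrder → Odd W.tamagawaProduct →
      W.rootNumber = -1 → W.mordellWeilRank = 1 → Finite (AddCommGroup.primaryComponent W.sha 2) →
      ∀ (ℓ k : ℕ) [Fact ℓ.Prime], IsLevelAtTwo W ℓ → 1 ≤ k → (2 ^ k : ℤ) ∣ (ℓ : ℤ) - 1 →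
        (2 ^ k : ℤ) ∣ W.frobeniusTrace ℓ - 2 →
        ∀ ψ : (ZMod ℓ)ˣ →* Multiplicative (ZMod (2 ^ k)), Function.Surjective ψ →
          InTwoPowZLoc 1 (levelSumTwo f ℓ k ψ) := by
  intro W _ _ M _ f hf _hper _hsurj _hT _hc hw _hr _hfin ℓ k _ hlev hk hℓk _ha ψ hψ
  obtain ⟨hℓ2, hN⟩ := ne_two_and_not_dvd_of_isLevelAtTwo W hlev
  exact levelSumTwo_inTwoPowZLoc_one W f hf (W.analyticRank_pos_of_rootNumber_eq_neg_one hw).ne' hℓ2 hN hk hℓk ψ hψ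

/-- **Clause (a) of K2-F VERBATIM when `#Ш(E)[2^∞] = 1`** (`s = 0`), under the stub's own binders: every row of the first
layer has `δ'_k(ℓ; ψ) ∈ 2^{min(k, s+1)} ℤ_{(2)}` with `s = ord₂ #Ш[2^∞] = 0`. [conjecture] half, kernel theorem. -/
theorem firstLayerLawAtTwo_clauseA_of_sha_two_eq_one :
    ∀ (W : WeierstrassCurve ℚ) [W.IsElliptic] [W.IsGloballyMinimal] {M : ℕ} [NeZero M]
      (f : CuspForm (Gamma0 M) 2), IsNewformOf W f → PeriodTransferAtTwo W f →
      (∀ n : ℕ, W.HasSurjectiveModNGaloisRep ((2 ^ n : ℕ) : ℤ)) → Odd W.torsionOrder → Odd W.tamagawaProduct →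
      W.rootNumber = -1 → W.mordellWeilRank = 1 → Finite (AddCommGroup.primaryComponent W.sha 2) →
      Nat.card (AddCommGroup.primaryComponent W.sha 2) = 1 →
      let s := padicValNat 2 (Nat.card (AddCommGroup.primaryComponent W.sha 2))
      ∀ (ℓ k : ℕ) [Fact ℓ.Prime], IsLevelAtTwo W ℓ → 1 ≤ k → (2 ^ k : ℤ) ∣ (ℓ : ℤ) - 1 →
        (2 ^ k : ℤ) ∣ W.frobeniusTrace ℓ - 2 →
        ∀ ψ : (ZMod ℓ)ˣ →* Multiplicative (ZMod (2 ^ k)), Function.Surjective ψ →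
          InTwoPowZLoc (min k (s + 1)) (levelSumTwo f ℓ k ψ) := by
  intro W _ _ M _ f hf hper hsurj hT hc hw hr hfin hsha
  simp only [hsha, padicValNat_one_right, zero_add]
  intro ℓ k _ hlev hk hℓk ha ψ hψ
  have hmin : min k 1 = 1 := by omega
  rw [hmin]
  exact firstLayerLawAtTwo_clauseA_mod_two W f hf hper hsurj hT hc hw hr hfin ℓ k hlev hk hℓk ha ψ hψ

/-- **Clause (a) of K2-F_an holds modulo `2` — under the stub's own binders** (`F1Sign2.AnalyticFirstLayerLawAtTwo`:
analytic rank one; the rational value `q` of `Ш_an` is idle). [conjecture] shadow, kernel theorem. -/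
theorem analyticFirstLayerLawAtTwo_clauseA_mod_two :
    ∀ (W : WeierstrassCurve ℚ) [W.IsElliptic] [W.IsGloballyMinimal] {M : ℕ} [NeZero M]
      (f : CuspForm (Gamma0 M) 2), IsNewformOf W f → PeriodTransferAtTwo W f →
      (∀ n : ℕ, W.HasSurjectiveModNGaloisRep ((2 ^ n : ℕ) : ℤ)) → Odd W.torsionOrder → Odd W.tamagawaProduct →
      W.rootNumber = -1 → W.analyticRank = 1 →
      ∀ q : ℚ, shaAn W = (q : ℂ) → q ≠ 0 →
      ∀ (ℓ k : ℕ) [Fact ℓ.Prime], IsLevelAtTwo W ℓ → 1 ≤ k → (2 ^ k : ℤ) ∣ (ℓ : ℤ) - 1 →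
        (2 ^ k : ℤ) ∣ W.frobeniusTrace ℓ - 2 →
        ∀ ψ : (ZMod ℓ)ˣ →* Multiplicative (ZMod (2 ^ k)), Function.Surjective ψ →
          InTwoPowZLoc 1 (levelSumTwo f ℓ k ψ) := by
  intro W _ _ M _ f hf _hper _hsurj _hT _hc _hw han q _hq _hq0 ℓ k _ hlev hk hℓk _ha ψ hψ
  obtain ⟨hℓ2, hN⟩ := ne_two_and_not_dvd_of_isLevelAtTwo W hlev
  exact levelSumTwo_inTwoPowZLoc_one W f hf (by rw [han]; exact one_ne_zero) hℓ2 hN hk hℓk ψ hψ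

/-- **Clause (a) of K2-F_an VERBATIM when `ord₂ Ш_an ≤ 0`** (`s_an = (ord₂ q).toNat = 0`; in particular when `Ш_an` is a
`2`-adic unit), under the stub's own binders. [conjecture] half, kernel theorem. -/
theorem analyticFirstLayerLawAtTwo_clauseA_of_padicValRat_le :
    ∀ (W : WeierstrassCurve ℚ) [W.IsElliptic] [W.IsGloballyMinimal] {M : ℕ} [NeZero M]
      (f : CuspForm (Gamma0 M) 2), IsNewformOf W f → PeriodTransferAtTwo W f →
      (∀ n : ℕ, W.HasSurjectiveModNGaloisRep ((2 ^ n : ℕ) : ℤ)) → Odd W.torsionOrder → Odd W.tamagawaProduct →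
      W.rootNumber = -1 → W.analyticRank = 1 →
      ∀ q : ℚ, shaAn W = (q : ℂ) → q ≠ 0 → padicValRat 2 q ≤ 0 →
      let s := (padicValRat 2 q).toNat
      ∀ (ℓ k : ℕ) [Fact ℓ.Prime], IsLevelAtTwo W ℓ → 1 ≤ k → (2 ^ k : ℤ) ∣ (ℓ : ℤ) - 1 →
        (2 ^ k : ℤ) ∣ W.frobeniusTrace ℓ - 2 →
        ∀ ψ : (ZMod ℓ)ˣ →* Multiplicative (ZMod (2 ^ k)), Function.Surjective ψ →
          InTwoPowZLoc (min k (s + 1)) (levelSumTwo f ℓ k ψ) := by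
  intro W _ _ M _ f hf hper hsurj hT hc hw han q hq hq0 hv
  have hs : (padicValRat 2 q).toNat = 0 := Int.toNat_of_nonpos hv
  simp only [hs, zero_add]
  intro ℓ k _ hlev hk hℓk ha ψ hψ
  have hmin : min k 1 = 1 := by omega
  rw [hmin]
  exact analyticFirstLayerLawAtTwo_clauseA_mod_two W f hf hper hsurj hT hc hw han q hq hq0 ℓ k hlev hk hℓk ha ψ hψ

end Summit.BirchSwinnertonDyer.BirchSwinnertonDyer.Theorems.RankOneAtTwoFkl

end
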